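import Summits.RiemannHypothesis.RiemannHypothesis.Theorems.WeilColumnBSplineFourierSine
import Summits.RiemannHypothesis.RiemannHypothesis.Theorems.WeilColumnThetaMajorantD2
import HarnessLib

/-!
# E1: the Poisson majorants of the PART XIX theta series WITH THE SINES KEPT (tier-2 theta certificate; RH-FREE)

WEIL column (LADDER-RH, W-P(P2); route `WeilSemilocal`, tier-2 twin residue (items 19172 / 19185 below the dodger floor);
HOME/cc-s2-1/gen22/TIER2-KERNEL-SPEC.md §2 (E1) / §5 (K1) / §6, THETA-CERT-cc6 §E1). Tier 1's D1/D2 (`norm_Θ_le`, `norm_mul_deriv_Θ_le`)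
bound `|sin| ≤ 1`; tier 2 keeps the first `K` harmonics' sines and majorises only the tail:

* §1 (profile level, any `u > 0`, `θ := 2πελ/(mu)`):
  `‖Σ_{n≥1} h(nu/λ)‖ ≤ (2(1+|α|)/π)·θ^{−m}·[Σ_{k=1}^{K}|sin kθ|^m k^{−(m+1)} + (ζ(m+1) − Σ_{k=1}^{K}k^{−(m+1)})]`
  (`norm_thetaSum_profile_le_sine`) and, for the moment profile `φ(y) = y·h′(y)`,
  `‖Σ_{n≥1} φ(nu/λ)‖ ≤ 2(λ/u)(2+2α)·θ^{−m}·[Σ_{k=1}^{K}(c₂ s_k^m + ε s_k^{m−1}(1 + θ⁻¹/k))k^{−m} + (ζ(m) − Σ_{k=1}^{K}k^{−m})(c₂ + ε(1 + θ⁻¹/(K+1)))]`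
  (`norm_thetaSum_moment_le_sine`; `s_k = |sin kθ|`);
* §2 (the witness `P : ThetaParams`, `u = u₁e^{−t}`, `θ = θ₀eᵗ`, `θ₀ := ζ⋆/m`, `M₀ := (Σ|cᵢ|/π)(m/ζ⋆)^m`, `M₁₀ := 2(λ/u₁)Σ|cᵢ|(m/ζ⋆)^m`):
  **`‖Θ(u₁e^{−t})‖ ≤ M₀·e^{−mt}·S(t)`** and **`‖u·Θ′(u)‖ ≤ M₁₀·e^{−(m−1)t}·S₁(t)`** (`norm_Θ_exp_le_sine`, `norm_mul_deriv_Θ_exp_le_sine`)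
  with `S`, `S₁` written EXACTLY as cc-s2-1's `ThetaTier2.Sfun θ₀ R m K t` / `S1fun θ₀ c₂ ε Rm m K t` unfold (any residues
  `R ≥ ζ(m+1) − Σ_{k≤K}k^{−(m+1)}`, `Rm ≥ ζ(m) − Σ_{k≤K}k^{−m}`), i.e. the E-side input of (K1); `M = M₀·ζ(m+1)` (`M_eq_M₀_mul_zetaTail`).
Hypothesis-free beyond `P.Admissible qn` (B-spline continuity from `WeilColumnBSplineContinuity`). Nothing here bears on the truth of RH.
-/

set_option linter.dupNamespace false

noncomputable section

open MeasureTheory Set Complex Filter Finset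
open scoped Real FourierTransform
open Literature.NumberTheory.LFunctions

namespace Summit.RiemannHypothesis.RiemannHypothesis.Theorems.WeilColumn.ThetaMellin

/-! ## §0 A casting fact for the symmetric lattice bound (`(n.natAbs : ℝ) = |n|` is `Nat.cast_natAbs` + `Int.cast_abs`) -/

/-- `|sin(|x|θ)| = |sin(xθ)|`. [folklore] -/
theorem abs_sin_abs_mul (x θ : ℝ) : |Real.sin (|x| * θ)| = |Real.sin (x * θ)| := by
  rcases abs_choice x with h | h
  · rw [h]
  · rw [h, neg_mul, Real.sin_neg, abs_neg]

/-! ## §1 The abstract E1 bounds (profile level) -/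

variable {c₁ m₀ c₂ ε α lam : ℝ} {m : ℕ}

/-- **E1 (sines kept) for the scaled profile**: with `θ = 2πελ/(mu)`, for every `K`,
`‖Σ_{n≥1} h(nu/λ)‖ ≤ (2(1+|α|)/π)·(θ⁻¹)^m·[Σ_{k=1}^{K}|sin kθ|^m/k^{m+1} + (Σ_{k≥1}k^{−(m+1)} − Σ_{k=1}^{K}k^{−(m+1)})]`.
Poisson majorant (p414433) + `norm_fourier_profile_le_sine` + the symmetric lattice bound, `K`-split of the harmonic series.
[this seat; THETA-CERT-cc6 §E1] -/
theorem norm_thetaSum_profile_le_sine (hm : 1 ≤ m) (hε : 0 < ε) (h1 : m₀ ≤ c₂ - ε)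
    (h2 : c₁ + ε < m₀) (hc₁ : 0 < c₁) (hα : α = (c₂ - ε - m₀) / (m₀ - c₁ - ε)) (hlam : 0 < lam)
    (hcont : Continuous (profile c₁ m₀ c₂ ε α m)) {u θ : ℝ} (hu : 0 < u) (hθ : θ = 2 * π * ε * lam / (m * u)) (K : ℕ) :
    ‖∑' n : ℕ, profile c₁ m₀ c₂ ε α m ((((n + 1 : ℕ) : ℝ) * u) / lam)‖ ≤
      (2 * (1 + |α|) / π) * θ⁻¹ ^ m *
        ((∑ k ∈ Ico 1 (K + 1), |Real.sin (k * θ)| ^ m / (k : ℝ) ^ (m + 1)) +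
          ((∑' k : ℕ, 1 / ((k : ℝ) + 1) ^ (m + 1)) - ∑ k ∈ Ico 1 (K + 1), 1 / (k : ℝ) ^ (m + 1))) := by
  have hm' : (0 : ℝ) < m := by exact_mod_cast hm
  have hθpos : 0 < θ := by rw [hθ]; positivity
  set h : ℝ → ℂ := profile c₁ m₀ c₂ ε α m with hh
  set G : ℝ → ℂ := fun y => h (lam⁻¹ * y) with hG
  -- hypotheses of the Poisson majorant for G
  have hGc : Continuous G := hcont.comp (continuous_const.mul continuous_id)
  have hGsupp : HasCompactSupport G := by
    have := (hasCompactSupport_profile (α := α) hm hε.le h1 h2.le).comp_homeomorph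
      (Homeomorph.mulLeft₀ lam⁻¹ (inv_ne_zero hlam.ne'))
    rw [hG, hh]
    exact this
  have hGneg : ∀ y ≤ 0, G y = 0 := fun y hy =>
    profile_eq_zero_of_nonpos hm hε.le h1 h2.le hc₁
      (by have := mul_nonpos_of_nonneg_of_nonpos (inv_nonneg.2 hlam.le) hy; simpa [hG] using this)
  have hFG : ∀ ξ : ℝ, 𝓕 G ξ = (lam : ℂ) * 𝓕 h (ξ * lam) := by
    intro ξ
    have := fourier_comp_mul h (inv_pos.2 hlam) ξ
    rw [hG, this, div_inv_eq_mul, Complex.ofReal_inv, inv_inv]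
  have hF0 : 𝓕 G 0 = 0 := by
    rw [Literature.NumberTheory.LFunctions.DFIDeterminant.fourier_zero_eq_integral, hG]
    rw [MeasureTheory.Measure.integral_comp_mul_left (fun y => h y) lam⁻¹]
    rw [hh, integral_profile_eq_zero h1 h2 hα, smul_zero]
  -- the symmetric termwise bound
  obtain ⟨D, hD⟩ : ∃ D : ℝ, D = u * (1 + |α|) / π * θ⁻¹ ^ m := ⟨_, rfl⟩
  have hD0 : 0 ≤ D := by rw [hD]; positivity
  obtain ⟨a, ha⟩ : ∃ a : ℕ → ℝ, a = fun k : ℕ => D * |Real.sin (k * θ)| ^ m / (k : ℝ) ^ (m + 1) := ⟨_, rfl⟩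
  obtain ⟨b, hb⟩ : ∃ b : ℕ → ℝ, b = fun k : ℕ => D * (1 / (k : ℝ) ^ (m + 1)) := ⟨_, rfl⟩
  have hab' : ∀ k, a k ≤ b k := fun k => by
    rw [ha, hb]; simp only; rw [mul_one_div]
    exact mul_div_pow_le_of_le_one hD0 (pow_le_one₀ (abs_nonneg _) (Real.abs_sin_le_one _)) (by positivity)
  have hab : ∀ k, K + 1 ≤ k → a k ≤ b k := fun k _ => hab' k
  have ha0 : ∀ k, 0 ≤ a k := fun k => by rw [ha]; positivity
  have hbs : Summable b := by rw [hb]; exact (summable_one_div_nat_pow' (s := m + 1) (by omega)).mul_left D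
  have has : Summable a := Summable.of_nonneg_of_le ha0 hab' hbs
  have hF : ∀ n : ℤ, n ≠ 0 → ‖𝓕 G (n / u)‖ ≤ a n.natAbs := by
    intro n hn
    have hn' : (n : ℝ) ≠ 0 := by exact_mod_cast hn
    have hna : 0 < |(n : ℝ)| := abs_pos.2 hn'
    have hξ : (n : ℝ) / u * lam ≠ 0 := by positivity
    rw [hFG, norm_mul, Complex.norm_real, Real.norm_of_nonneg hlam.le]
    have hb := norm_fourier_profile_le_sine (α := α) hm hε h1 h2.le hξ
    have e1 : 2 * π * (ε / m) * ((n : ℝ) / u * lam) = n * θ := by rw [hθ]; field_simp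
    have e2 : (m : ℝ) / (2 * π * ε * |(n : ℝ) / u * lam|) = θ⁻¹ / |(n : ℝ)| := by
      rw [hθ, abs_mul, abs_div, abs_of_pos hu, abs_of_pos hlam]; field_simp
    have e3 : |(n : ℝ) / u * lam| = |(n : ℝ)| * lam / u := by rw [abs_mul, abs_div, abs_of_pos hu, abs_of_pos hlam]; ring
    rw [e1, e2, e3] at hb
    have hak : a n.natAbs = D * |Real.sin (n * θ)| ^ m / |(n : ℝ)| ^ (m + 1) := by
      rw [ha]; simp only; rw [Nat.cast_natAbs, Int.cast_abs, abs_sin_abs_mul]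
    rw [hak]
    refine (mul_le_mul_of_nonneg_left hb hlam.le).trans (le_of_eq ?_)
    rw [hD, mul_pow, div_pow, pow_succ]
    field_simp
  obtain ⟨hsum, hle⟩ := summable_tsum_int_norm_le_of_bound (F := 𝓕 G) (u := u) a has hF hF0
  have hsplit := tsum_succ_le_sum_Ico_add_sub has hbs hab
  have hP := norm_thetaSum_le_inv_mul_tsum hGc hGsupp hGneg hu hsum
  have e : (fun n : ℕ => G (((n + 1 : ℕ) : ℝ) * u)) = fun n : ℕ => h ((((n + 1 : ℕ) : ℝ) * u) / lam) := by
    funext n; simp only [hG]; congr 1; rw [div_eq_inv_mul]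
  rw [e] at hP
  refine hP.trans ?_
  -- evaluate the majorant series
  have hbt : ∑' k : ℕ, b (k + 1) = D * ∑' k : ℕ, 1 / ((k : ℝ) + 1) ^ (m + 1) := by
    rw [hb]; simp only; rw [tsum_mul_left]; push_cast; rfl
  have hbK : ∑ k ∈ Ico 1 (K + 1), b k = D * ∑ k ∈ Ico 1 (K + 1), 1 / (k : ℝ) ^ (m + 1) := by
    rw [hb]; simp only; rw [Finset.mul_sum]
  have haK : ∑ k ∈ Ico 1 (K + 1), a k = D * ∑ k ∈ Ico 1 (K + 1), |Real.sin (k * θ)| ^ m / (k : ℝ) ^ (m + 1) := by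
    rw [ha]; simp only; rw [Finset.mul_sum]; refine Finset.sum_congr rfl fun k _ => by ring
  rw [hbt, hbK, haK] at hsplit
  have hfin : u⁻¹ * ∑' n : ℤ, ‖𝓕 G (n / u)‖ ≤ u⁻¹ * (2 * (D * (∑ k ∈ Ico 1 (K + 1), |Real.sin (k * θ)| ^ m / (k : ℝ) ^ (m + 1))
      + (D * ∑' k : ℕ, 1 / ((k : ℝ) + 1) ^ (m + 1) - D * ∑ k ∈ Ico 1 (K + 1), 1 / (k : ℝ) ^ (m + 1)))) :=
    mul_le_mul_of_nonneg_left (hle.trans (by linarith)) (inv_nonneg.2 hu.le)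
  refine hfin.trans (le_of_eq ?_)
  rw [hD]
  field_simp

/-- **E1 for the moment profile (sines kept)**: with `θ = 2πελ/(mu)`, `φ(y) = y·h′(y)`, `m ≥ 2`, every `K`,
`‖Σ_{n≥1} φ(nu/λ)‖ ≤ 2(λ/u)(2+2α)(θ⁻¹)^m·[Σ_{k=1}^{K}(c₂ s_k^m + ε s_k^{m−1}(1 + θ⁻¹/k))/k^m + (Σ_{k≥1}k^{−m} − Σ_{k=1}^{K}k^{−m})(c₂ + ε(1 + θ⁻¹/(K+1)))]`
(`s_k = |sin kθ|`; tail: `s ≤ 1`, `θ⁻¹/k ≤ θ⁻¹/(K+1)` for `k > K`). [this seat; THETA-CERT-cc6 §E1 (D2 with the sines kept)] -/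
theorem norm_thetaSum_moment_le_sine (hm : 2 ≤ m) (hε : 0 < ε) (h1 : m₀ ≤ c₂ - ε)
    (h2 : c₁ + ε < m₀) (hc₁ : 0 < c₁) (hα : α = (c₂ - ε - m₀) / (m₀ - c₁ - ε)) (hlam : 0 < lam)
    (hρ : Continuous (profileDensity ε m)) {u θ : ℝ} (hu : 0 < u) (hθ : θ = 2 * π * ε * lam / (m * u)) (K : ℕ) :
    ‖∑' n : ℕ, mulId (profileDeriv c₁ m₀ c₂ ε α m) ((((n + 1 : ℕ) : ℝ) * u) / lam)‖ ≤
      2 * (lam / u) * (2 + 2 * α) * θ⁻¹ ^ m *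
        ((∑ k ∈ Ico 1 (K + 1), (c₂ * |Real.sin (k * θ)| ^ m + ε * |Real.sin (k * θ)| ^ (m - 1) * (1 + θ⁻¹ / k)) / (k : ℝ) ^ m)
          + ((∑' k : ℕ, 1 / ((k : ℝ) + 1) ^ m) - ∑ k ∈ Ico 1 (K + 1), 1 / (k : ℝ) ^ m) * (c₂ + ε * (1 + θ⁻¹ / (K + 1)))) := by
  have hm1 : 1 ≤ m := le_trans (by norm_num) hm
  have hm' : (0 : ℝ) < m := by exact_mod_cast hm1
  have hθpos : 0 < θ := by rw [hθ]; positivity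
  have hα0 : 0 ≤ α := by rw [hα]; exact div_nonneg (by linarith) (by linarith)
  have hc₂ : 0 ≤ c₂ := by linarith [hε.le]
  set φ : ℝ → ℂ := mulId (profileDeriv c₁ m₀ c₂ ε α m) with hφ
  set Φ : ℝ → ℂ := fun y => φ (lam⁻¹ * y) with hΦ
  -- hypotheses of the Poisson majorant for Φ (as in D2)
  have hφc : Continuous φ := Complex.continuous_ofReal.mul (continuous_profileDeriv _ _ _ _ _ hρ)
  have hΦc : Continuous Φ := hφc.comp (continuous_const.mul continuous_id)
  have hφz : ∀ y, y ∉ Icc c₁ c₂ → φ y = 0 := fun y hy => by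
    simp only [hφ, mulId, profileDeriv_eq_zero hm1 hε.le h1 h2.le hy, mul_zero]
  have hφsupp : HasCompactSupport φ :=
    HasCompactSupport.of_support_subset_isCompact isCompact_Icc fun y hy => by
      by_contra hc; exact hy (hφz y hc)
  have hΦsupp : HasCompactSupport Φ := by
    have := hφsupp.comp_homeomorph (Homeomorph.mulLeft₀ lam⁻¹ (inv_ne_zero hlam.ne'))
    rw [hΦ]; exact this
  have hΦneg : ∀ y ≤ 0, Φ y = 0 := fun y hy => hφz _ fun hmem => by
    have : lam⁻¹ * y ≤ 0 := mul_nonpos_of_nonneg_of_nonpos (inv_nonneg.2 hlam.le) hy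
    linarith [hmem.1]
  have hFΦ : ∀ ξ : ℝ, 𝓕 Φ ξ = (lam : ℂ) * 𝓕 φ (ξ * lam) := by
    intro ξ
    have := fourier_comp_mul φ (inv_pos.2 hlam) ξ
    rw [hΦ, this, div_inv_eq_mul, Complex.ofReal_inv, inv_inv]
  have hF0 : 𝓕 Φ 0 = 0 := by
    rw [hFΦ, zero_mul, hφ, fourier_momentProfile_zero hm1 hε.le, mul_zero]
    have hden : m₀ - c₁ - ε ≠ 0 := by linarith
    rw [hα]; field_simp
  -- the symmetric termwise bound
  obtain ⟨D, hD⟩ : ∃ D : ℝ, D = lam * (2 + 2 * α) * θ⁻¹ ^ m := ⟨_, rfl⟩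
  have hD0 : 0 ≤ D := by rw [hD]; positivity
  obtain ⟨T, hT⟩ : ∃ T : ℝ, T = c₂ + ε * (1 + θ⁻¹ / (K + 1)) := ⟨_, rfl⟩
  have hT0 : 0 ≤ T := by rw [hT]; positivity
  -- the numerator `N k = c₂ s_k^m + ε s_k^{m−1}(1 + θ⁻¹/k)` and its two majorants
  obtain ⟨N, hN⟩ : ∃ N : ℕ → ℝ,
      N = fun k : ℕ => c₂ * |Real.sin (k * θ)| ^ m + ε * |Real.sin (k * θ)| ^ (m - 1) * (1 + θ⁻¹ / k) := ⟨_, rfl⟩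
  have hN0 : ∀ k, 0 ≤ N k := fun k => by rw [hN]; positivity
  have hNle : ∀ k : ℕ, ∀ Y : ℝ, θ⁻¹ / k ≤ Y → N k ≤ c₂ + ε * (1 + Y) := by
    intro k Y hY
    rw [hN]
    simp only
    have hs1 : |Real.sin (k * θ)| ≤ 1 := Real.abs_sin_le_one _
    have hs0 : 0 ≤ |Real.sin (k * θ)| := abs_nonneg _
    have hsm : |Real.sin (k * θ)| ^ m ≤ 1 := pow_le_one₀ hs0 hs1
    have hsm1 : |Real.sin (k * θ)| ^ (m - 1) ≤ 1 := pow_le_one₀ hs0 hs1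
    have hik0 : 0 ≤ θ⁻¹ / k := by positivity
    have t1 : c₂ * |Real.sin (k * θ)| ^ m ≤ c₂ := by nlinarith
    have t2 : ε * |Real.sin (k * θ)| ^ (m - 1) * (1 + θ⁻¹ / k) ≤ ε * (1 + Y) := by
      have : |Real.sin (k * θ)| ^ (m - 1) * (1 + θ⁻¹ / k) ≤ 1 * (1 + Y) :=
        mul_le_mul hsm1 (by linarith) (by positivity) zero_le_one
      nlinarith [hε.le]
    linarith
  obtain ⟨a, ha⟩ : ∃ a : ℕ → ℝ, a = fun k : ℕ => D * (N k / (k : ℝ) ^ m) := ⟨_, rfl⟩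
  obtain ⟨b, hb⟩ : ∃ b : ℕ → ℝ, b = fun k : ℕ => D * T * (1 / (k : ℝ) ^ m) := ⟨_, rfl⟩
  have ha0 : ∀ k, 0 ≤ a k := fun k => by rw [ha]; have := hN0 k; positivity
  have hab : ∀ k, K + 1 ≤ k → a k ≤ b k := by
    intro k hk
    have hk0 : (0 : ℝ) < k := by exact_mod_cast (show 0 < k by omega)
    have hik : θ⁻¹ / k ≤ θ⁻¹ / (K + 1) :=
      div_le_div_of_nonneg_left (inv_nonneg.2 hθpos.le) (by positivity) (by exact_mod_cast hk)
    have hnum : N k ≤ T := by rw [hT]; exact hNle k _ hik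
    have h1 : D * (N k / (k : ℝ) ^ m) ≤ D * (T / (k : ℝ) ^ m) :=
      mul_le_mul_of_nonneg_left (div_le_div_of_nonneg_right (c := (k : ℝ) ^ m) hnum (by positivity)) hD0
    rw [ha, hb]; simp only; rw [mul_one_div, mul_div_assoc]
    exact h1
  have hbs : Summable b := by rw [hb]; exact (summable_one_div_nat_pow' (s := m) hm).mul_left (D * T)
  -- `a` is summable: it is majorised by `D (c₂ + ε(1 + θ⁻¹)) / k^m` everywhere
  have has : Summable a := by
    have hb's : Summable fun k : ℕ => D * (c₂ + ε * (1 + θ⁻¹)) * (1 / (k : ℝ) ^ m) :=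
      (summable_one_div_nat_pow' (s := m) hm).mul_left _
    refine Summable.of_nonneg_of_le ha0 (fun k => ?_) hb's
    rcases Nat.eq_zero_or_pos k with hk | hk
    · subst hk
      rw [ha]
      simp [zero_pow (by omega : m ≠ 0)]
    have hk0 : (0 : ℝ) < k := by exact_mod_cast hk
    have hik : θ⁻¹ / k ≤ θ⁻¹ := div_le_self (inv_nonneg.2 hθpos.le) (by exact_mod_cast hk)
    have hnum : N k ≤ c₂ + ε * (1 + θ⁻¹) := hNle k _ hik
    have h1 : D * (N k / (k : ℝ) ^ m) ≤ D * ((c₂ + ε * (1 + θ⁻¹)) / (k : ℝ) ^ m) :=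
      mul_le_mul_of_nonneg_left (div_le_div_of_nonneg_right (c := (k : ℝ) ^ m) hnum (by positivity)) hD0
    rw [ha]; simp only; rw [mul_one_div, mul_div_assoc]
    exact h1
  have hF : ∀ n : ℤ, n ≠ 0 → ‖𝓕 Φ (n / u)‖ ≤ a n.natAbs := by
    intro n hn
    have hn' : (n : ℝ) ≠ 0 := by exact_mod_cast hn
    have hna : 0 < |(n : ℝ)| := abs_pos.2 hn'
    have hξ : (n : ℝ) / u * lam ≠ 0 := by positivity
    rw [hFΦ, norm_mul, Complex.norm_real, Real.norm_of_nonneg hlam.le]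
    have hb := norm_fourier_momentProfile_le_sine (α := α) hm1 hε hc₁.le h2.le h1 hα0 hξ
    have e1 : 2 * π * (ε / m) * ((n : ℝ) / u * lam) = n * θ := by rw [hθ]; field_simp
    have e2 : (m : ℝ) / (2 * π * ε * |(n : ℝ) / u * lam|) = θ⁻¹ / |(n : ℝ)| := by
      rw [hθ, abs_mul, abs_div, abs_of_pos hu, abs_of_pos hlam]; field_simp
    rw [e1, e2] at hb
    have hak : a n.natAbs = D * ((c₂ * |Real.sin (n * θ)| ^ m +
        ε * |Real.sin (n * θ)| ^ (m - 1) * (1 + θ⁻¹ / |(n : ℝ)|)) / |(n : ℝ)| ^ m) := by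
      rw [ha, hN]; simp only; rw [Nat.cast_natAbs, Int.cast_abs, abs_sin_abs_mul]
    rw [hak]
    refine (mul_le_mul_of_nonneg_left hb hlam.le).trans (le_of_eq ?_)
    rw [hD, div_pow]
    field_simp
  obtain ⟨hsum, hle⟩ := summable_tsum_int_norm_le_of_bound (F := 𝓕 Φ) (u := u) a has hF hF0
  have hsplit := tsum_succ_le_sum_Ico_add_sub has hbs hab
  have hP := norm_thetaSum_le_inv_mul_tsum hΦc hΦsupp hΦneg hu hsum
  have e : (fun n : ℕ => Φ (((n + 1 : ℕ) : ℝ) * u)) = fun n : ℕ => φ ((((n + 1 : ℕ) : ℝ) * u) / lam) := by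
    funext n; simp only [hΦ]; congr 1; rw [div_eq_inv_mul]
  rw [e] at hP
  refine hP.trans ?_
  have hbt : ∑' k : ℕ, b (k + 1) = D * T * ∑' k : ℕ, 1 / ((k : ℝ) + 1) ^ m := by
    rw [hb]; simp only; rw [tsum_mul_left]; push_cast; rfl
  have hbK : ∑ k ∈ Ico 1 (K + 1), b k = D * T * ∑ k ∈ Ico 1 (K + 1), 1 / (k : ℝ) ^ m := by
    rw [hb]; simp only; rw [Finset.mul_sum]
  have haK : ∑ k ∈ Ico 1 (K + 1), a k =
      D * ∑ k ∈ Ico 1 (K + 1), (c₂ * |Real.sin (k * θ)| ^ m + ε * |Real.sin (k * θ)| ^ (m - 1) * (1 + θ⁻¹ / k)) / (k : ℝ) ^ m := by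
    rw [ha, hN]; simp only; rw [Finset.mul_sum]
  rw [hbt, hbK, haK] at hsplit
  have hfin : u⁻¹ * ∑' n : ℤ, ‖𝓕 Φ (n / u)‖ ≤ u⁻¹ * (2 * (D * (∑ k ∈ Ico 1 (K + 1),
      (c₂ * |Real.sin (k * θ)| ^ m + ε * |Real.sin (k * θ)| ^ (m - 1) * (1 + θ⁻¹ / k)) / (k : ℝ) ^ m)
      + (D * T * ∑' k : ℕ, 1 / ((k : ℝ) + 1) ^ m - D * T * ∑ k ∈ Ico 1 (K + 1), 1 / (k : ℝ) ^ m))) :=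
    mul_le_mul_of_nonneg_left (hle.trans (by linarith)) (inv_nonneg.2 hu.le)
  refine hfin.trans (le_of_eq ?_)
  rw [hD, hT]
  field_simp

/-! ## §2 E1 for the witness: `θ₀`, `M₀`, `M₁₀` and the two bounds in the shape of `ThetaTier2.Sfun` / `S1fun` -/

namespace ThetaParams

variable (P : ThetaParams)

/-- E1's base angle `θ₀ := ζ⋆/m` (`θ_u = θ₀eᵗ` at `u = u₁e^{−t}`). [this cell, THETA-CERT-cc6 §E1] -/
def θ₀ : ℝ := P.zstar / P.m

/-- E1's constant `M₀ := (Σ|cᵢ|/π)·(m/ζ⋆)^m` (so that tier 1's `M = M₀·ζ(m+1)`). [this cell, THETA-CERT-cc6 §E1] -/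
def M₀ : ℝ := P.csum / π * (P.m / P.zstar) ^ P.m

/-- E1's derivative constant `M₁₀ := 2(λ/u₁)·Σ|cᵢ|·(m/ζ⋆)^m`. [this cell, THETA-CERT-cc6 §E1] -/
def M₁₀ : ℝ := 2 * (P.lam / P.u₁) * P.csum * (P.m / P.zstar) ^ P.m

/-- Tier 1's `M` is `M₀·ζ(m+1)` (`M̄` of TIER2-KERNEL-SPEC §1). [folklore] -/
theorem M_eq_M₀_mul_zetaTail : P.M = P.M₀ * zetaTail (P.m + 1) := by
  unfold M M₀; ring

/-- Positivity bookkeeping for an admissible row: `0 < ε`, `0 < λ`, `0 < ζ⋆`, `0 < θ₀`, `0 ≤ α`, `0 ≤ M₀`, `0 ≤ M₁₀`. [folklore] -/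
theorem e1_pos {qn : ℕ} (hP : P.Admissible qn) :
    0 < P.ε ∧ 0 < P.lam ∧ 0 < P.zstar ∧ 0 < P.θ₀ ∧ 0 ≤ P.α ∧ 0 ≤ P.M₀ ∧ 0 ≤ P.M₁₀ := by
  have hm : 1 ≤ P.m := le_trans (by norm_num) hP.three_le
  have hm' : (0 : ℝ) < P.m := by exact_mod_cast hm
  have hε : 0 < P.ε := by have := hP.delta_pos; have := hP.c₂_pos; unfold ε; positivity
  have hlam : 0 < P.lam := by have := hP.c₂_pos; unfold lam; positivity
  have hz : 0 < P.zstar := by unfold zstar u₁; positivity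
  have hα : 0 ≤ P.α := div_nonneg (by linarith [hP.seed₂]) (by linarith [hP.seed₁])
  have hcs : 0 ≤ P.csum := by unfold csum; linarith
  refine ⟨hε, hlam, hz, ?_, hα, ?_, ?_⟩
  · unfold θ₀; positivity
  · unfold M₀; positivity
  · unfold M₁₀ u₁; positivity

/-- The base angle at depth `t`: `2πελ/(m·u₁e^{−t}) = θ₀eᵗ`. [folklore] -/
theorem theta_at_depth {qn : ℕ} (hP : P.Admissible qn) (t : ℝ) :
    P.θ₀ * Real.exp t = 2 * π * P.ε * P.lam / (P.m * (P.u₁ * Real.exp (-t))) := by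
  have hm' : (0 : ℝ) < P.m := by exact_mod_cast (le_trans (by norm_num) hP.three_le : 1 ≤ P.m)
  have hu₁ : 0 < P.u₁ := Real.exp_pos _
  have he : Real.exp (-t) = (Real.exp t)⁻¹ := Real.exp_neg t
  rw [he]
  unfold θ₀ zstar
  field_simp

/-- **E1 — `‖Θ(u₁e^{−t})‖ ≤ M₀·e^{−mt}·S(t)`** for every depth `t`, every `K`, and every residue `R ≥ ζ(m+1) − Σ_{k≤K}k^{−(m+1)}`;
the bracket is LITERALLY `ThetaTier2.Sfun P.θ₀ R P.m K t` unfolded. [this seat; THETA-CERT-cc6 §E1, TIER2-KERNEL-SPEC §2/§5 (K1)] -/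
theorem norm_Θ_exp_le_sine {qn : ℕ} (hP : P.Admissible qn) (K : ℕ) (t : ℝ) {R : ℝ}
    (hR : zetaTail (P.m + 1) - ∑ k ∈ Ico 1 (K + 1), 1 / (k : ℝ) ^ (P.m + 1) ≤ R) :
    ‖P.Θ (P.u₁ * Real.exp (-t))‖ ≤
      P.M₀ * Real.exp (-(P.m : ℝ) * t) *
        ((∑ k ∈ Ico 1 (K + 1), |Real.sin (k * (P.θ₀ * Real.exp t))| ^ P.m / (k : ℝ) ^ (P.m + 1)) + R) := by
  obtain ⟨hε, hlam, hz, hθ₀, hα, hM₀, -⟩ := P.e1_pos hP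
  have hm3 := hP.three_le
  have hm : 1 ≤ P.m := le_trans (by norm_num) hm3
  have hu : 0 < P.u₁ * Real.exp (-t) := mul_pos (Real.exp_pos _) (Real.exp_pos _)
  have hcont : Continuous P.h := continuous_profile_of_two_le (by omega) hε
  have hD1 := norm_thetaSum_profile_le_sine (α := P.α) (lam := P.lam) hm hε hP.seed₂.le hP.seed₁ hP.c₁_pos rfl hlam hcont
    hu (P.theta_at_depth hP t) K
  rw [abs_of_nonneg hα] at hD1
  rw [Θ_apply]
  refine hD1.trans ?_
  -- constants: (2(1+α)/π)·(θ₀eᵗ)⁻¹^m = M₀ e^{−mt}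
  have hconst : 2 * (1 + P.α) / π * (P.θ₀ * Real.exp t)⁻¹ ^ P.m = P.M₀ * Real.exp (-(P.m : ℝ) * t) := by
    have h1 : (P.θ₀ * Real.exp t)⁻¹ = (P.m / P.zstar) * Real.exp (-t) := by
      rw [Real.exp_neg, mul_inv]; unfold θ₀; rw [inv_div]
    have h3 : Real.exp (-t) ^ P.m = Real.exp (-(P.m : ℝ) * t) := by
      rw [← Real.exp_nat_mul]; congr 1; ring
    rw [h1, mul_pow, h3]
    unfold M₀ csum
    ring
  rw [hconst]
  have hS0 : 0 ≤ P.M₀ * Real.exp (-(P.m : ℝ) * t) := by positivity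
  have hres : zetaTail (P.m + 1) = ∑' k : ℕ, 1 / ((k : ℝ) + 1) ^ (P.m + 1) := rfl
  rw [← hres]
  exact mul_le_mul_of_nonneg_left (by linarith) hS0

/-- **E1 (derivative) — `‖u·Θ′(u)‖ ≤ M₁₀·e^{−(m−1)t}·S₁(t)`** at `u = u₁e^{−t}`, every `K`, every residue `Rm ≥ ζ(m) − Σ_{k≤K}k^{−m}`;
the bracket is LITERALLY `ThetaTier2.S1fun P.θ₀ P.c₂ P.ε Rm P.m K t` unfolded. [this seat; THETA-CERT-cc6 §E1, TIER2-KERNEL-SPEC §2/§5 (K1)] -/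
theorem norm_mul_deriv_Θ_exp_le_sine {qn : ℕ} (hP : P.Admissible qn) (K : ℕ) (t : ℝ) {Rm : ℝ}
    (hRm : zetaTail P.m - ∑ k ∈ Ico 1 (K + 1), 1 / (k : ℝ) ^ P.m ≤ Rm) :
    ‖((P.u₁ * Real.exp (-t) : ℝ) : ℂ) * deriv P.Θ (P.u₁ * Real.exp (-t))‖ ≤
      P.M₁₀ * Real.exp (-(P.m - 1 : ℝ) * t) *
        ((∑ k ∈ Ico 1 (K + 1), (P.c₂ * |Real.sin (k * (P.θ₀ * Real.exp t))| ^ P.m +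
            P.ε * |Real.sin (k * (P.θ₀ * Real.exp t))| ^ (P.m - 1) * (1 + (P.θ₀ * Real.exp t)⁻¹ / k)) / (k : ℝ) ^ P.m)
          + Rm * (P.c₂ + P.ε * (1 + (P.θ₀ * Real.exp t)⁻¹ / (K + 1)))) := by
  obtain ⟨hε, hlam, hz, hθ₀, hα, -, hM₁₀⟩ := P.e1_pos hP
  have hm3 := hP.three_le
  have hm : 1 ≤ P.m := le_trans (by norm_num) hm3
  set u : ℝ := P.u₁ * Real.exp (-t) with hu_def
  have hu : 0 < u := mul_pos (Real.exp_pos _) (Real.exp_pos _)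
  have hρ := P.continuous_profileDensity hP
  -- Θ′ and the moment series
  obtain ⟨D, hD, hmul⟩ := P.hasDerivAt_Θ hP hu
  rw [hD.deriv, hmul]
  have hD2 := norm_thetaSum_moment_le_sine (α := P.α) (lam := P.lam) (by omega) hε hP.seed₂.le hP.seed₁ hP.c₁_pos rfl hlam hρ
    hu (P.theta_at_depth hP t) K
  rw [thetaSum]
  refine hD2.trans ?_
  have hθt : 0 < P.θ₀ * Real.exp t := mul_pos hθ₀ (Real.exp_pos t)
  -- constants: 2(λ/u)(2+2α)(θ₀eᵗ)⁻¹^m = M₁₀ e^{−(m−1)t}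
  have hconst : 2 * (P.lam / u) * (2 + 2 * P.α) * (P.θ₀ * Real.exp t)⁻¹ ^ P.m = P.M₁₀ * Real.exp (-(P.m - 1 : ℝ) * t) := by
    have hu₁ : P.u₁ ≠ 0 := (Real.exp_pos _).ne'
    have het : Real.exp t ≠ 0 := (Real.exp_pos t).ne'
    have h1 : (P.θ₀ * Real.exp t)⁻¹ = (P.m / P.zstar) * Real.exp (-t) := by
      rw [Real.exp_neg, mul_inv]; unfold θ₀; rw [inv_div]
    have h2 : P.lam / u = P.lam / P.u₁ * Real.exp t := by
      rw [hu_def, Real.exp_neg]; field_simp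
    have h3 : Real.exp t * Real.exp (-t) ^ P.m = Real.exp (-(P.m - 1 : ℝ) * t) := by
      rw [← Real.exp_nat_mul, ← Real.exp_add]; congr 1; ring
    rw [h1, h2, mul_pow]
    unfold M₁₀ csum
    rw [← h3]
    ring
  rw [hconst]
  have hS0 : 0 ≤ P.M₁₀ * Real.exp (-(P.m - 1 : ℝ) * t) := by positivity
  refine mul_le_mul_of_nonneg_left ?_ hS0
  have hT : 0 ≤ P.c₂ + P.ε * (1 + (P.θ₀ * Real.exp t)⁻¹ / (K + 1)) := by
    have := hP.c₂_pos; positivity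
  have hres : zetaTail P.m = ∑' k : ℕ, 1 / ((k : ℝ) + 1) ^ P.m := rfl
  rw [← hres]
  have := mul_le_mul_of_nonneg_right hRm hT
  linarith

end ThetaParams

end Summit.RiemannHypothesis.RiemannHypothesis.Theorems.WeilColumn.ThetaMellin
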